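import Mathlib
import HarnessLib
import Summits.Langlands.Langlands.Theses.CompatibleFamilySplit
import Literature.NumberTheory.GaloisRepresentations.SatakeFamilyOfFramedGaloisRep
import Literature.NumberTheory.Automorphic.GLnAdelicStructureProofs

/-!
# Birth skeleton (BC3) for crux stmt-Langlands-18969
`Summit.Langlands.Langlands.Theses.CompatibleFamilySplit.GeometricCompanions` — line `birth`

Route `route-Langlands-CompatibleFamilySplit` (rev 6; `closes (hF : CompatibleFamilyAutomorphy)
(hC : GeometricCompanions) (hW : SatakeAvatarExistence) (hP : PadicMemberCompatibility)
(hA : CompatibilityAwayFromL) (hU : AvatarConjugacy) (hD : DatumIndependence) : Langlands`; this crux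
is `hC`, rank 3). THE CRUX (Taylor, *Galois representations*, ICM 2002 long version, Conj. 3, first
bullet, for irreducible `ρ`, over an arbitrary number field): for every number field `K`, `n ≥ 1`,
`(ℓ, ι : ℚ̄_ℓ ≃ ℂ)` and every IRREDUCIBLE `ρ : Γ_K → GL_n(ℚ̄_ℓ)` unramified a.e. and de Rham above `ℓ`
(Fontaine's PINNED datum `fontainePstAdicCompletion`), there is a Satake family
`a : places(K) → Multiset ℂ` read by `ρ` through `ι` a.e. (`arithFrobPolyOfSatake ι q_v 1 (a v)`)
such that at EVERY `(ℓ′, ι′)` some SEMISIMPLE, a.e.-unramified, pinned-de-Rham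
`ρ′ : Γ_K → GL_n(ℚ̄_ℓ′)` reads `a` through `ι′` a.e. ("`ρ` sits in an `ι`-compatible family of
companions").

## The line: potential automorphy over the soluble-index subfields + Brauer–Taylor (BLGGT Thm. 5.4.1)

The only engine in print that puts an `ℓ`-adic `ρ` over a NUMBER field into a compatible family
without proving its automorphy is the argument of Barnet-Lamb–Gee–Geraghty–Taylor, *Potential
automorphy and change of weight*, Ann. of Math. 179 (2014), Thm. 5.4.1 (arXiv:1010.2561, p. 39–40;
"a generalization of results of Dieulefait in dimension 2"), read page by page for this skeleton:
(i) potential automorphy (their Thm. 4.5.1) over a finite Galois `F′/F` chosen linearly disjoint from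
the monodromy-component field `F⁰` of `r` (so `r|_{Γ_{F′}}` and all `r|_{Γ_{F″}}`, `F ⊆ F″ ⊆ F′`, stay
irreducible); (ii) for every intermediate `F″` with `F′/F″` SOLUBLE, automorphy of `r|_{Γ_{F″}}`
(BLGHT Lemma 1.4 = soluble descent GIVEN the Galois representation); (iii) the Galois avatars
`r_{ℓ′,ι′}(π^{(F″)})` of those cuspidal representations at every `(ℓ′, ι′)`; (iv) Brauer's induction
theorem for `Gal(F′/F)` (`1 = Σ nᵢ Ind_{F′ᵢ/F} ψᵢ`, `F′/F′ᵢ` soluble), the Grothendieck-group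
formalism (Mackey, Frobenius reciprocity, the pairing `(A,A) = Σ mᵢ²`), Serre's `ℓ`-independence of
the component group (their Lemma (cc)) and the computation `(A_α, A_α)_{F,ℓ′} = (1,1)_{F,ℓ′} = 1`,
which makes the virtual representation `Σ nᵢ Ind (r_{ℓ′,ι′}(π^{(F′ᵢ)}) ⊗ ι′⁻¹ψᵢ)` a TRUE semisimple
representation with the Frobenius traces of `r` transported by `ι′⁻¹ ∘ ι` — the companion. No
descent of automorphy to `F` is needed (the route's point: the SolvableImage obstruction blocks
automorphy, not Galois-side companions). The skeleton cuts the crux exactly along (i)+(ii) / (iii) /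
(iv):

* `stub_solublePotentialAutomorphy` (XL, OPEN CORE — said openly): for `ρ` irreducible and pinned-
  geometric there is a finite Galois `K′/K` with `ρ|_{Γ_{K′}}` still irreducible such that over EVERY
  intermediate number field `E` with `Gal(K′/E)` soluble some L-algebraic cuspidal `π_E` of
  `GL_n(𝔸_E)` is Satake–Frobenius compatible with `ρ|_{Γ_E}` a.e. (= (i)+(ii); BLGGT Thm. 4.5.1 +
  linear disjointness from `F⁰` + BLGHT Lemma 1.4; `n = 1`: class field theory + Weil. Known for
  regular, totally odd, polarizable, potentially diagonalizable `ρ` over CM/TR `K` with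
  `ρ̄|_{K(ζ_ℓ)}` irreducible, `ℓ ≥ 2(n+1)`; OPEN for Hodge-irregular `ρ`, for `K` of mixed signature,
  for residually small `ρ` — and the soluble descent (ii) itself needs avatars over `E`.) The first
  two ingredients are the registered stubs of the sibling skeleton
  `Cruxes/PotentialAutomorphy/Lines/birth.lean` (route LiftDescend), re-usable verbatim.
* `stub_geometricAvatars` (L/XL, open in general): every L-algebraic cuspidal `π` of `GL_n(𝔸_E)`,
  `E` any number field, has at EVERY `(ℓ′, ι′)` a SEMISIMPLE, a.e.-unramified, pinned-de-Rham
  `ρ′ : Γ_E → GL_n(ℚ̄_ℓ′)` Satake–Frobenius compatible with `π` a.e. (= (iii); direction (A) of the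
  summit at Satake level plus geometry; implied by the route's own W⁺ = `SatakeAvatarExistence`
  (irreducible avatars) with P(i) = `PadicMemberCompatibility` (de Rham above `ℓ`); known for regular
  `π` over CM/TR fields — Harris–Lan–Taylor–Thorne / Scholze give exactly a SEMISIMPLE `ρ′`, purity /
  de Rham by Caraiani and A'Campo 2023; open for irregular `π` and general `E`.)
* `stub_brauerTaylor` (XL, literature-grade THEOREM SCHEMA — BLGGT p. 40, Galois side only): if `ρ`
  (irreducible, pinned-geometric) has, over every soluble-index intermediate field `E` of some finite
  Galois `K′/K` keeping `ρ` irreducible, COMPANIONS in the crux's exact sense (a family `a_E` read by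
  `ρ|_{Γ_E}` through `ι` a.e. and, at every `(ℓ′, ι′)`, a semisimple pinned-geometric `ρ′_E` reading
  `a_E` through `ι′` a.e.), then `ρ` has companions over `K` (= (iv): Brauer + Mackey + Serre's
  component theorem + positivity of the pairing; `FramedGaloisRep.induce` and its Frobenius formula
  are in the tree, Brauer's induction theorem and the Grothendieck ring of continuous `ℓ`-adic
  representations are not).
* `GeometricCompanions_of : stub 1 → stub 2 → stub 3 → GeometricCompanions` — kernel-checked, no
  `sorry`: for `ρ` irreducible pinned-geometric take `K′` from STUB 1; for each soluble-index `E` the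
  cuspidal `π_E` of STUB 1 (at `hcpt := isCompact_glFiniteIntegralLevel_holds n E`) and its avatars
  from STUB 2; the common family is `a_E := satakeFamilyOfFramedGaloisRep ι 1 (ρ|_{Γ_E})`, read by
  `ρ|_{Γ_E}` a.e. (`eventually_hasFrobCharpolyAt_satakeFamilyOfFramedGaloisRep`) and by each avatar
  a.e. (uniqueness of Satake parameters, Flath: `hasSatakeParamAt_unique_holds`, and
  `satakeFamilyOfFramedGaloisRep_eq_of_hasFrobCharpolyAt`); STUB 3 concludes the crux BY NAME. All
  three stubs are load-bearing.

Every stub is a consequence of the summit `Langlands` on paper (STUB 1 with `K′ := K` and direction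
(B); STUB 2 = direction (A) weakened; STUB 3 ⇐ the crux, which is a certified consequence of the
summit, evidence `SubsOfLanglands.lean`), so none is refutable short of `¬Langlands`; none gives the
crux or the summit cheaply (BC3 probes, `bc/GeometricCompanions_probes.lean`: 6/6 fail).

Shape (for `ledger skeleton check` / `#h21_check_skeleton`): stubs `theorem stub_<name> : <signature>
:= by sorry` (closed statements over existing declarations only, no `:=` inside a signature);
`_Goal.stub_<name> : Prop := type_of% @stub_<name>` names each statement; the composition takes
`(h₁ : _Goal.stub_solublePotentialAutomorphy) (h₂ : _Goal.stub_geometricAvatars)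
(h₃ : _Goal.stub_brauerTaylor)` and concludes the route decl by its fully qualified name; the final
`example` feeds the three stubs to it. Sorries: exactly the three stubs.

Disproof used: none exists — `ledger crux ls stmt-Langlands-18969` lists no workfiles at registration
time (2026-08-17: no `Disproof.lean`, no `Negative/` lemma, no dead line, no crux idea). Item evidence
read: `SubsOfLanglands.lean` (planner BC2: `Langlands → GeometricCompanions`, kernel-checked),
`special.lean` (BC5: the trivial family inhabits the crux), refuter `ATTACK.md` / `Probe.lean`
(crux-attack at birth: SURVIVES; `selfCompanion`: the `(ℓ′,ι′) = (ℓ,ι)` instance is witnessed by `ρ`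
itself with `a := satakeFamilyOfFramedGaloisRep ι 1 ρ`, so all content sits at `(ℓ′,ι′) ≠ (ℓ,ι)` —
honoured: STUB 3's conclusion is quantified over all `(ℓ′, ι′)` and its datum over all of them too;
`family_pinned`: no junk freedom in `a`). `ledger negatives --problem Langlands` (3 entries:
SplitPrimeInductionDeinduction, OrdinaryPrimeTransportRankinSelbergPoleCount,
K3KugaSatakeDescentSerreTypeAnchor) contains nothing of the shape of these stubs. The earlier
(unregistered) birth skeleton of the route planner, `GeometricCompanions_birth.lean` (evidence,
2 stubs `stub_avatarCompletePotentialAutomorphy → stub_brauerTaylor`), is refined here: its first stub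
is split into the automorphic half (STUB 1) and the avatar half (STUB 2), so that STUB 2 coincides
with what W⁺ ∧ P(i) of the route deliver and STUB 3 becomes a purely Galois-theoretic statement.
-/

set_option linter.dupNamespace false

noncomputable section

namespace Summit.Langlands.Langlands.Cruxes.GeometricCompanions.Birth

open Summit.Langlands.Langlands.Theses.CompatibleFamilySplit
open scoped NumberField
open NumberField IsDedekindDomain Filter
open Literature.NumberTheory.GaloisRepresentations Literature.NumberTheory.Automorphic
open Literature.NumberTheory.PAdicHodge

/-! ## 1. The three stubs -/

/-- **STUB 1 — potential automorphy over the soluble-index subfields, keeping irreducibility**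
(the OPEN CORE of the line; ingredients (i)+(ii) of BLGGT Thm. 5.4.1). Let `K` be a number field,
`n ≥ 1`, `ι : ℚ̄_ℓ ≃ ℂ` and `ρ : Γ_K → GL_n(ℚ̄_ℓ)` irreducible, unramified at all but finitely many
places and de Rham above `ℓ` for Fontaine's pinned datum. Then there is a finite Galois extension
`K′/K` (a number field) such that `ρ|_{Γ_{K′}}` is still irreducible and, for EVERY intermediate
number field `K ⊆ E ⊆ K′` with `Gal(K′/E)` soluble, some L-algebraic cuspidal `π_E` of `GL_n(𝔸_E)`
is Satake–Frobenius compatible with `ρ|_{Γ_E} = ρ ∘ absGaloisRestrict K E` at all but finitely many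
places of `E` (for every compactness witness `hcpt`, a provable proposition:
`isCompact_glFiniteIntegralLevel_holds`). In print this is: potential automorphy over `K′` chosen
linearly disjoint from the monodromy-component field of `ρ` (BLGGT Thm. 4.5.1, "`F′` linearly disjoint
from `F^{avoid}`"; registered as the two stubs of `Cruxes/PotentialAutomorphy/Lines/birth.lean`), then
soluble descent of automorphy from `K′` to each such `E` GIVEN the Galois representation `ρ|_{Γ_E}`
(BLGHT Lemma 1.4 / BLGGT Lemma 2.2.2: cyclic steps, Arthur–Clozel base change, strong multiplicity
one, twisting by a character of `Gal`). Known: `n = 1` (class field theory; de Rham characters are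
locally algebraic, Weil's algebraic Hecke characters); regular, totally odd, polarizable, potentially
diagonalizable `ρ` over CM / totally real `K` with `ρ̄|_{K(ζ_ℓ)}` irreducible and `ℓ ≥ 2(n+1)`
(BLGGT Thm. 4.5.1 + Lemma 2.2.2). OPEN: Hodge-irregular `ρ` (even Artin representations, abelian
varieties of dimension ≥ 3 over ℚ), `K` neither totally real nor CM, residually small `ρ`; and the
descent step (ii) needs Galois avatars over `E` (cf. STUB 2). Implied by the summit (take `K′ := K`,
direction (B) over `E ≅ K`). [cite: BarnetlambEtAl2014, Thm. 4.5.1 and Lemma 2.2.2]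
[cite: TaylorGaloisRepresentations2004, Conj. 3] -/
theorem stub_solublePotentialAutomorphy :
    ∀ (K : Type) [Field K] [NumberField K] (n : ℕ), 0 < n →
      ∀ (ℓ : ℕ) [Fact ℓ.Prime] (ι : PadicAlgCl ℓ ≃+* ℂ)
        (ρ : FramedGaloisRep K (PadicAlgCl ℓ) n),
        ρ.toGaloisRep.IsIrreducible →
        ((∀ᶠ v : HeightOneSpectrum (𝓞 K) in cofinite, ρ.IsUnramifiedAt v) ∧
          ∀ (v : HeightOneSpectrum (𝓞 K)) (hv : ((ℓ : ℕ) : 𝓞 K) ∈ v.asIdeal),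
            (fontainePstAdicCompletion v ℓ hv).IsDeRhamFramed (ρ.toLocal v)) →
        ∃ (K' : Type) (_ : Field K') (_ : NumberField K') (_ : Algebra K K') (_ : IsGalois K K'),
          (ρ.restrictField K').toGaloisRep.IsIrreducible ∧
          ∀ (E : Type) [Field E] [NumberField E] [Algebra K E] [Algebra E K']
            [IsScalarTower K E K'], IsSolvable (K' ≃ₐ[E] K') →
            ∀ hcpt : isCompact_glFiniteIntegralLevel n E,
              ∃ π : CuspidalAutomorphicRepData n E hcpt, π.1.IsLAlgebraic ∧
                ∀ᶠ w : HeightOneSpectrum (𝓞 E) in cofinite,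
                  SatakeFrobCompatibleAt ι π.1 (ρ.restrictField E) w := by
  sorry

/-- **STUB 2 — semisimple geometric avatars of cuspidal L-algebraic `π`, at every `(ℓ′, ι′)`**
(ingredient (iii)). For every number field `E`, `n ≥ 1`, every L-algebraic cuspidal `π` of
`GL_n(𝔸_E)` and every `(ℓ′, ι′ : ℚ̄_ℓ′ ≃ ℂ)` there is a SEMISIMPLE `ρ′ : Γ_E → GL_n(ℚ̄_ℓ′)`,
unramified at all but finitely many places, de Rham above `ℓ′` for Fontaine's pinned datum, and
Satake–Frobenius compatible with `π` (through `ι′`) at all but finitely many places. This is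
direction (A) of the summit weakened to the Satake level (no local–global compatibility, semisimple
instead of irreducible) plus geometry; inside the route it follows from W⁺ (`SatakeAvatarExistence`,
stmt-Langlands-17415: an IRREDUCIBLE avatar, hence semisimple) and P(i) (`PadicMemberCompatibility`,
stmt-Langlands-17534: de Rham above `ℓ′`), unramifiedness a.e. being part of
`SatakeFrobCompatibleAt`. Known: regular (cohomological) `π` over CM or totally real `E` —
Harris–Lan–Taylor–Thorne 2016 Thm. A / Scholze 2015 construct exactly a SEMISIMPLE `ρ′` with the right
Frobenius polynomials a.e. (tree: `exists_galoisRep_of_regularAlgebraic` in the polarizable sector),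
de Rham above `ℓ′` by A'Campo 2023 (and Caraiani in the polarizable case); `n = 1` by Weil / Serre.
OPEN: irregular `π` (Maass forms of eigenvalue `1/4`, non-cohomological weights: no construction at
any `ℓ′`), `E` neither totally real nor CM. [cite: HarrisLanTaylorThorneRMS2016, Thm. A]
[cite: BuzzardGeeLMS2014, Conj. 3.2.2] -/
theorem stub_geometricAvatars :
    ∀ (E : Type) [Field E] [NumberField E] (n : ℕ) (hcpt : isCompact_glFiniteIntegralLevel n E),
      0 < n → ∀ π : CuspidalAutomorphicRepData n E hcpt, π.1.IsLAlgebraic →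
        ∀ (ℓ' : ℕ) [Fact ℓ'.Prime] (ι' : PadicAlgCl ℓ' ≃+* ℂ),
          ∃ ρ' : FramedGaloisRep E (PadicAlgCl ℓ') n,
            ρ'.toGaloisRep.IsSemisimple ∧
            ((∀ᶠ w : HeightOneSpectrum (𝓞 E) in cofinite, ρ'.IsUnramifiedAt w) ∧
              ∀ (w : HeightOneSpectrum (𝓞 E)) (hw : ((ℓ' : ℕ) : 𝓞 E) ∈ w.asIdeal),
                (fontainePstAdicCompletion w ℓ' hw).IsDeRhamFramed (ρ'.toLocal w)) ∧
            ∀ᶠ w : HeightOneSpectrum (𝓞 E) in cofinite, SatakeFrobCompatibleAt ι' π.1 ρ' w := by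
  sorry

/-- **STUB 3 — Brauer–Taylor descent of companions along a Brauer datum** (ingredient (iv);
literature-grade theorem schema, BLGGT Thm. 5.4.1, proof, p. 40; Galois side only). Let `ρ : Γ_K →
GL_n(ℚ̄_ℓ)` be irreducible and pinned-geometric, `ι : ℚ̄_ℓ ≃ ℂ`. Suppose there is a finite Galois
`K′/K` with `ρ|_{Γ_{K′}}` irreducible such that over EVERY intermediate number field `E` with
`Gal(K′/E)` soluble, `ρ|_{Γ_E}` HAS COMPANIONS in the crux's exact sense: a family
`a_E : places(E) → Multiset ℂ` read by `ρ|_{Γ_E}` through `ι` a.e., and at every `(ℓ′, ι′)` a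
semisimple, a.e.-unramified, pinned-de-Rham `ρ′_E : Γ_E → GL_n(ℚ̄_ℓ′)` reading `a_E` through `ι′`
a.e. Then `ρ` has companions over `K`: a family `a` read by `ρ` through `ι` a.e. carrying at every
`(ℓ′, ι′)` a semisimple pinned-geometric member. Paper proof (BLGGT p. 39–40, with `r|_{G_{F″}}`-
companions in place of `r_{ℓ′,ι′}(π^{(F″)})`, which is all their argument uses): `a :=` the
`ι`-Satake family of `ρ`; Brauer's theorem `1 = Σᵢ nᵢ Ind_{Gal(K′/Eᵢ)}^{Gal(K′/K)} ψᵢ` with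
`Gal(K′/Eᵢ)` elementary (soluble); `A := Σᵢ nᵢ Ind_{Γ_{Eᵢ}}^{Γ_K} (ρ′_{Eᵢ} ⊗ ι′⁻¹ψᵢ)` in the
Grothendieck group of continuous semisimple `ℓ′`-adic representations of `Γ_K`; its Frobenius traces
are `ι′⁻¹ι (tr ρ(Frob_v))` a.e. (induced-character formula + the companions' char-polys, compatible
under restriction and conjugation by Chebotarev + Brauer–Nesbitt); Serre's `ℓ`-independence of the
monodromy component group for the family `{ρ|_{Γ_E}} ∪ {ρ′_E}` (BLGGT Lemma (cc)) gives
`Γ_E → G′(ℚ̄_ℓ′) × Gal(K′/E)` Zariski dense, whence `(A_α, A_α)_{K,ℓ′} = (1,1) = 1` per isotypic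
piece (Mackey + Frobenius reciprocity) and `A` is the class of a TRUE semisimple representation —
the companion `ρ′`; it is unramified a.e. and de Rham above `ℓ′` as a subquotient of inductions of
such. XL to formalise: the tree has `FramedGaloisRep.induce` with its Frobenius char-poly formula
(`FramedGaloisRepInduce`) and `satakeFamilyOfFramedGaloisRep_restrictField`; Brauer's induction
theorem, the Grothendieck ring and Serre's component theorem are not in the tree. BLGGT run it for
REGULAR `r` (distinct Hodge–Tate numbers separate the pieces `r_α`); the irregular case needs the
isotypic refinement. Implied by the crux (drop the datum), hence by the summit.
[cite: BarnetlambEtAl2014, Thm. 5.4.1] [cite: SerreAbelianLadic1968, Ch. I §2.3] -/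
theorem stub_brauerTaylor :
    ∀ (K : Type) [Field K] [NumberField K] (n : ℕ), 0 < n →
      ∀ (ℓ : ℕ) [Fact ℓ.Prime] (ι : PadicAlgCl ℓ ≃+* ℂ)
        (ρ : FramedGaloisRep K (PadicAlgCl ℓ) n),
        ρ.toGaloisRep.IsIrreducible →
        ((∀ᶠ v : HeightOneSpectrum (𝓞 K) in cofinite, ρ.IsUnramifiedAt v) ∧
          ∀ (v : HeightOneSpectrum (𝓞 K)) (hv : ((ℓ : ℕ) : 𝓞 K) ∈ v.asIdeal),
            (fontainePstAdicCompletion v ℓ hv).IsDeRhamFramed (ρ.toLocal v)) →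
        (∃ (K' : Type) (_ : Field K') (_ : NumberField K') (_ : Algebra K K') (_ : IsGalois K K'),
          (ρ.restrictField K').toGaloisRep.IsIrreducible ∧
          ∀ (E : Type) [Field E] [NumberField E] [Algebra K E] [Algebra E K']
            [IsScalarTower K E K'], IsSolvable (K' ≃ₐ[E] K') →
            ∃ aE : HeightOneSpectrum (𝓞 E) → Multiset ℂ,
              (∀ᶠ w : HeightOneSpectrum (𝓞 E) in cofinite,
                (ρ.restrictField E).IsUnramifiedAt w ∧
                  (ρ.restrictField E).HasFrobCharpolyAt w
                    (arithFrobPolyOfSatake ι w.residueCard 1 (aE w))) ∧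
              ∀ (ℓ' : ℕ) [Fact ℓ'.Prime] (ι' : PadicAlgCl ℓ' ≃+* ℂ),
                ∃ ρ' : FramedGaloisRep E (PadicAlgCl ℓ') n,
                  ρ'.toGaloisRep.IsSemisimple ∧
                  ((∀ᶠ w : HeightOneSpectrum (𝓞 E) in cofinite, ρ'.IsUnramifiedAt w) ∧
                    ∀ (w : HeightOneSpectrum (𝓞 E)) (hw : ((ℓ' : ℕ) : 𝓞 E) ∈ w.asIdeal),
                      (fontainePstAdicCompletion w ℓ' hw).IsDeRhamFramed (ρ'.toLocal w)) ∧
                  ∀ᶠ w : HeightOneSpectrum (𝓞 E) in cofinite, ρ'.IsUnramifiedAt w ∧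
                    ρ'.HasFrobCharpolyAt w (arithFrobPolyOfSatake ι' w.residueCard 1 (aE w))) →
        ∃ a : HeightOneSpectrum (𝓞 K) → Multiset ℂ,
          (∀ᶠ v : HeightOneSpectrum (𝓞 K) in cofinite, ρ.IsUnramifiedAt v ∧
            ρ.HasFrobCharpolyAt v (arithFrobPolyOfSatake ι v.residueCard 1 (a v))) ∧
          ∀ (ℓ' : ℕ) [Fact ℓ'.Prime] (ι' : PadicAlgCl ℓ' ≃+* ℂ),
            ∃ ρ' : FramedGaloisRep K (PadicAlgCl ℓ') n,
              ρ'.toGaloisRep.IsSemisimple ∧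
              ((∀ᶠ v : HeightOneSpectrum (𝓞 K) in cofinite, ρ'.IsUnramifiedAt v) ∧
                ∀ (v : HeightOneSpectrum (𝓞 K)) (hv : ((ℓ' : ℕ) : 𝓞 K) ∈ v.asIdeal),
                  (fontainePstAdicCompletion v ℓ' hv).IsDeRhamFramed (ρ'.toLocal v)) ∧
              ∀ᶠ v : HeightOneSpectrum (𝓞 K) in cofinite, ρ'.IsUnramifiedAt v ∧
                ρ'.HasFrobCharpolyAt v (arithFrobPolyOfSatake ι' v.residueCard 1 (a v)) := by
  sorry

/-! ## 2. The stub statements as named propositions (the composition's hypotheses, by name)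

`_Goal` is internal on purpose: audits listing the file's declarations by short name find the
`stub_*` THEOREMS, while `#h21_check_skeleton` accepts the hypotheses of `GeometricCompanions_of` by
the stub names they carry. Each `_Goal.stub_x` is `type_of% @stub_x` — no text duplicated, no `sorry`
inherited. -/

namespace _Goal

/-- The statement of `stub_solublePotentialAutomorphy`, as a named `Prop` (literally its type).
[folklore] -/
def stub_solublePotentialAutomorphy : Prop :=
  type_of% @Summit.Langlands.Langlands.Cruxes.GeometricCompanions.Birth.stub_solublePotentialAutomorphy

/-- The statement of `stub_geometricAvatars`, as a named `Prop` (literally its type). [folklore] -/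
def stub_geometricAvatars : Prop :=
  type_of% @Summit.Langlands.Langlands.Cruxes.GeometricCompanions.Birth.stub_geometricAvatars

/-- The statement of `stub_brauerTaylor`, as a named `Prop` (literally its type). [folklore] -/
def stub_brauerTaylor : Prop :=
  type_of% @Summit.Langlands.Langlands.Cruxes.GeometricCompanions.Birth.stub_brauerTaylor

end _Goal

/-! ## 3. The composition (kernel-checked, no `sorry`): PA over soluble-index subfields + avatars
⇒ potential companions along a Brauer datum ⇒ (Brauer–Taylor) companions = the crux, by name -/

/-- **`GeometricCompanions` from the three stubs.** For `ρ` irreducible and pinned-geometric: STUB 1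
gives a finite Galois `K′/K` keeping `ρ` irreducible and, over each soluble-index intermediate `E`,
an L-algebraic cuspidal `π_E` matching `ρ|_{Γ_E}` a.e.; STUB 2 gives `π_E` a semisimple
pinned-geometric avatar at every `(ℓ′, ι′)`; with the common family
`a_E := satakeFamilyOfFramedGaloisRep ι 1 (ρ|_{Γ_E})` (read by `ρ|_{Γ_E}` a.e. by
`eventually_hasFrobCharpolyAt_satakeFamilyOfFramedGaloisRep`, and by each avatar a.e. by uniqueness
of Satake parameters `hasSatakeParamAt_unique_holds` and
`satakeFamilyOfFramedGaloisRep_eq_of_hasFrobCharpolyAt`) this is the Brauer datum of STUB 3, which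
returns the companions of `ρ` over `K`. The hypotheses are, by name, the statements of the three
stubs; the conclusion is the route decl
`Summit.Langlands.Langlands.Theses.CompatibleFamilySplit.GeometricCompanions`. [folklore] -/
theorem GeometricCompanions_of (h₁ : _Goal.stub_solublePotentialAutomorphy)
    (h₂ : _Goal.stub_geometricAvatars) (h₃ : _Goal.stub_brauerTaylor) :
    Summit.Langlands.Langlands.Theses.CompatibleFamilySplit.GeometricCompanions := by
  unfold _Goal.stub_solublePotentialAutomorphy at h₁
  unfold _Goal.stub_geometricAvatars at h₂
  unfold _Goal.stub_brauerTaylor at h₃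
  intro K _ _ n hn ℓ _ ι ρ hirr hgeo
  -- the Brauer field `K'` and potential automorphy over its soluble-index subfields (STUB 1)
  obtain ⟨K', _, _, _, _, hirr', hPA⟩ := h₁ K n hn ℓ ι ρ hirr hgeo
  -- Brauer–Taylor (STUB 3), fed with the potential companions built from STUB 1 + STUB 2
  refine h₃ K n hn ℓ ι ρ hirr hgeo
    ⟨K', inferInstance, inferInstance, inferInstance, inferInstance, hirr', ?_⟩
  intro E _ _ _ _ _ hsol
  obtain ⟨π, hL, hπρ⟩ := hPA E hsol (isCompact_glFiniteIntegralLevel_holds n E)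
  refine ⟨satakeFamilyOfFramedGaloisRep ι 1 (ρ.restrictField E), ?_, ?_⟩
  · -- `ρ|_{Γ_E}` reads its own `ι`-Satake family wherever it is unramified
    exact eventually_hasFrobCharpolyAt_satakeFamilyOfFramedGaloisRep ι 1
      (hπρ.mono fun w ⟨_, _, hur, _⟩ => hur)
  · intro ℓ' _ ι'
    -- the avatar of `π_E` at `(ℓ', ι')` (STUB 2) reads the same family: Satake parameters are unique
    obtain ⟨ρ', hss, hgeo', hπρ'⟩ := h₂ E n _ hn π hL ℓ' ι'
    refine ⟨ρ', hss, hgeo', ?_⟩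
    filter_upwards [hπρ, hπρ'] with w ⟨α, hπα, hur, hP⟩ ⟨α', hπα', hur', hP'⟩
    have hαα' : α = α' := π.1.hasSatakeParamAt_unique_holds hπα hπα'
    rw [satakeFamilyOfFramedGaloisRep_eq_of_hasFrobCharpolyAt hP, hαα']
    exact ⟨hur', hP'⟩

/-- By-name sanity check (an `example`, not a declaration of the file): the three stubs feed the
composition as they stand. -/
example : Summit.Langlands.Langlands.Theses.CompatibleFamilySplit.GeometricCompanions :=
  GeometricCompanions_of stub_solublePotentialAutomorphy stub_geometricAvatars stub_brauerTaylor

end Summit.Langlands.Langlands.Cruxes.GeometricCompanions.Birth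

end
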